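import Summits.Ventures.HodgeRepro2.T7SupportTorusProjector
import Summits.Ventures.HodgeRepro2.T7SupportWeightTorusContinuous

/-!
# The second-torus projector is an orthogonal projection; under multiplicity one `hq ⟺ ⟪u_B, u_A⟫ ≠ 0`
(support, seat p1)

For the projector `P_q x = ∫_K conj(w^q) • τ(ρ_B(w)) x dw` of `T7SupportTorusProjector` (unitary `τ` on a complete inner
product space, strongly continuous along `ρ_B`):

* `P_q x` is a `ρ_B`-weight vector of weight `q` (`isWeightVector_torusProj`: the substitution `w ↦ w'⁻¹ w`, left
  invariance of the Haar measure of the circle);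
* `P_q` is self-adjoint, `⟪P_q x, y⟫ = ⟪x, P_q y⟫` (`inner_torusProj_left`: unitarity and the inversion invariance
  `w ↦ w⁻¹` of the Haar measure);
* hence, when the weight-`q` space is the LINE of a unit vector `u` (a displayed multiplicity-one hypothesis `hmult`),
  **`P_q x = ⟪u, x⟫ • u`** (`torusProj_eq_inner_smul`) and the `(b′)` hypothesis of row 703 reads
  **`Φ_q(1) ≠ 0 ⟺ ⟪u, τ(h⁻¹) v⟫ ≠ 0 ⟺ ⟪τ(h) u, v⟫ ≠ 0`** (`fourierCoeff_one_ne_zero_iff_inner`): with `u_B := τ(h) u`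
  the `(T_B, q)`-weight vector (`T_B = h ρ_B h⁻¹`) and `v = u_A`, this is row 696's «the component `⟨u_B, u_A⟩ ≠ 0`» and
  L3-ARGUMENT §4a's formulation, now a kernel iff under the displayed multiplicity one.

Nothing here is about any specific group, the adelic group, or any period.
Blind lane: Mathlib + the HodgeRepro2 prefix only; no sorry; axioms ⊆ {propext, Classical.choice, Quot.sound}.
-/

namespace Summit.Ventures.HodgeRepro2.T7SupportTorusProjectorLine

open MeasureTheory
open scoped InnerProductSpace
open T5HaarCircle T7SupportWeightTorusOrbital T7SupportOneVectorOrbital T7SupportOneVectorBound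
  T7SupportTorusProjector

variable {G : Type*} [Group G] {V : Type*} [NormedAddCommGroup V] [InnerProductSpace ℂ V]

/-- `conj(((w'⁻¹ w)^q)) = w'^q · conj(w^q)` -/
theorem conj_inv_mul_zpow (w' w : Circle) (q : ℤ) :
    (starRingEnd ℂ) (((w'⁻¹ * w : Circle) : ℂ) ^ q) = (w' : ℂ) ^ q * (starRingEnd ℂ) ((w : ℂ) ^ q) := by
  rw [conj_zpow_mul, conj_zpow_eq_inv w'⁻¹ q, Circle.coe_inv, inv_zpow, inv_inv]

/-- a weight vector is strongly continuous along the torus: `w ↦ τ(ρ_B(w)) u = w^q • u` -/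
theorem continuous_of_isWeightVector {τ : G →* (V →ₗ[ℂ] V)} {ρB : Circle →* G} {q : ℤ} {u : V}
    (hu : IsWeightVector τ ρB q u) : Continuous fun w : Circle => τ (ρB w) u := by
  have e : (fun w : Circle => τ (ρB w) u) = fun w : Circle => ((w : ℂ) ^ q) • u := funext fun w => hu w
  rw [e]
  exact ((continuous_subtype_val).zpow₀ q fun w => Or.inl (Circle.coe_ne_zero w)).smul continuous_const

variable [MeasurableSpace Circle] [BorelSpace Circle] [CompleteSpace V]

/-- **`P_q x` is a weight vector of weight `q`** -/
theorem isWeightVector_torusProj {τ : G →* (V →ₗ[ℂ] V)} (hτ : IsUnitaryRep τ) (ρB : Circle →* G) (q : ℤ) {x : V}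
    (hx : Continuous fun w : Circle => τ (ρB w) x) : IsWeightVector τ ρB q (torusProj τ ρB q x) := by
  intro w'
  have hint := integrable_of_continuous (continuous_integrand τ ρB q hx)
  unfold torusProj
  rw [← unitaryCLM_apply hτ (ρB w'), ← ContinuousLinearMap.integral_comp_comm _ hint, ← integral_smul]
  set F : Circle → V := fun w => (starRingEnd ℂ) (((w'⁻¹ * w : Circle) : ℂ) ^ q) • τ (ρB w) x with hF
  have e : ∀ w : Circle, unitaryCLM hτ (ρB w') ((starRingEnd ℂ) ((w : ℂ) ^ q) • τ (ρB w) x) = F (w' * w) := by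
    intro w
    rw [hF]
    simp only
    rw [inv_mul_cancel_left, unitaryCLM_apply, map_smul, ← Module.End.mul_apply, ← map_mul, ← map_mul]
  simp_rw [e]
  rw [integral_mul_left_eq_self F w', hF]
  simp_rw [conj_inv_mul_zpow, mul_smul]

/-- **`P_q` is self-adjoint**: `⟪P_q x, y⟫ = ⟪x, P_q y⟫` -/
theorem inner_torusProj_left {τ : G →* (V →ₗ[ℂ] V)} (hτ : IsUnitaryRep τ) (ρB : Circle →* G) (q : ℤ) {x y : V}
    (hx : Continuous fun w : Circle => τ (ρB w) x) (hy : Continuous fun w : Circle => τ (ρB w) y) :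
    ⟪torusProj τ ρB q x, y⟫_ℂ = ⟪x, torusProj τ ρB q y⟫_ℂ := by
  have hintx := integrable_of_continuous (continuous_integrand τ ρB q hx)
  have hinty := integrable_of_continuous (continuous_integrand τ ρB q hy)
  unfold torusProj
  rw [inner_integral_left hintx, ← integral_inner hinty]
  set Gf : Circle → ℂ := fun w => ((w : ℂ) ^ q)⁻¹ * ⟪x, τ (ρB w) y⟫_ℂ with hG
  have e : ∀ w : Circle, ⟪(starRingEnd ℂ) ((w : ℂ) ^ q) • τ (ρB w) x, y⟫_ℂ = Gf w⁻¹ := by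
    intro w
    rw [hG]
    simp only
    rw [inner_smul_left, Complex.conj_conj, Circle.coe_inv, inv_zpow, inv_inv]
    congr 1
    have h1 := inner_apply_eq_inner_inv hτ (ρB w)⁻¹ y x
    rw [inv_inv, ← map_inv] at h1
    exact h1.symm
  simp_rw [e]
  rw [integral_inv_eq_self Gf (haarCircle : Measure Circle), hG]
  simp_rw [inner_smul_right, conj_zpow_eq_inv]

/-- **under multiplicity one, `P_q x = ⟪u, x⟫ • u`** for a unit weight vector `u` spanning the weight-`q` space -/
theorem torusProj_eq_inner_smul {τ : G →* (V →ₗ[ℂ] V)} (hτ : IsUnitaryRep τ) (ρB : Circle →* G) (q : ℤ) {u : V}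
    (hu : IsWeightVector τ ρB q u) (hu1 : ‖u‖ = 1)
    (hmult : ∀ y, IsWeightVector τ ρB q y → ∃ c : ℂ, y = c • u) {x : V}
    (hx : Continuous fun w : Circle => τ (ρB w) x) :
    torusProj τ ρB q x = ⟪u, x⟫_ℂ • u := by
  obtain ⟨c, hc⟩ := hmult _ (isWeightVector_torusProj hτ ρB q hx)
  have h1 : ⟪u, torusProj τ ρB q x⟫_ℂ = c := by
    rw [hc, inner_smul_right, inner_self_eq_norm_sq_to_K, hu1]
    simp
  have h2 : ⟪u, torusProj τ ρB q x⟫_ℂ = ⟪u, x⟫_ℂ := by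
    rw [← inner_torusProj_left hτ ρB q (continuous_of_isWeightVector hu) hx, torusProj_weightVector hu q, if_pos rfl,
      one_smul]
  rw [hc, ← h1, h2]

/-- **`hq` under multiplicity one: `Φ_q(1) ≠ 0 ⟺ ⟪u, τ(h⁻¹) v⟫ ≠ 0 ⟺ ⟪τ(h) u, v⟫ ≠ 0`** — with `u_B = τ(h) u` the
`(T_B, q)`-weight vector, the component `⟨u_B, u_A⟩` of row 696 / L3-ARGUMENT §4a -/
theorem fourierCoeff_one_ne_zero_iff_inner {τ : G →* (V →ₗ[ℂ] V)} (hτ : IsUnitaryRep τ) (v : V) (h : G)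
    (ρB : Circle →* G) (q : ℤ) (hx : Continuous fun w : Circle => τ (ρB w) (τ h⁻¹ v)) {u : V}
    (hu : IsWeightVector τ ρB q u) (hu1 : ‖u‖ = 1)
    (hmult : ∀ y, IsWeightVector τ ρB q y → ∃ c : ℂ, y = c • u) :
    (T7SupportOneVectorOrbital.fourierCoeff τ v h ρB q 1 ≠ 0 ↔ ⟪u, τ h⁻¹ v⟫_ℂ ≠ 0) ∧
      ⟪u, τ h⁻¹ v⟫_ℂ = ⟪τ h u, v⟫_ℂ := by
  have hu0 : u ≠ 0 := by
    intro h0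
    rw [h0, norm_zero] at hu1
    exact zero_ne_one hu1
  refine ⟨?_, ?_⟩
  · rw [fourierCoeff_one_ne_zero_iff hτ v h ρB q hx, torusProj_eq_inner_smul hτ ρB q hu hu1 hmult hx,
      smul_ne_zero_iff]
    exact ⟨fun hh => hh.1, fun hh => ⟨hh, hu0⟩⟩
  · have := inner_apply_eq_inner_inv hτ h⁻¹ v u
    rw [inv_inv] at this
    exact this

end Summit.Ventures.HodgeRepro2.T7SupportTorusProjectorLine
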